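import Summits.CriticalPhenomena.CardyFormulaZ2.Theorems.CardyComplexConeEdgePrecompactUFRSArmDomination

/-!
# Arm domination, INITIAL case with a nearby exit: the two-scale junction strands at the start vertex
(line `qkz-strip-boundary-arm` of crux `CardyComplexCone.EdgePrecompact`, stmt-CriticalPhenomena-11387;
analysis of the registered residual `ufrs_initialExitNearCase_cert` of the corrected arm domination
`ufrs_armDomination2`, see `…UFRSArmDominationInitial.lean` and `…UFRSArmDominationResiduals.lean`)

The residual INITIAL configuration "exit near": the first stretch `S₀ = O₀ a [0, n]` of the
exploration of `E` runs from the start corner `a` (marked edge `e_a = cSrc a`) to the `2ρ`-deep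
ball `B(E.δ v, ρ)`; the run `R₁ = O₁ a' [0, T]` of the translate `shiftData E w` from its start
corner `a' = a + w` shares no corner with `S₀`, never enters the ball and leaves the inner faces
of the translate at `T + 1` — so `q = O₁ a' T` is THE exit corner of the translate, at its second
marked edge `e_b + w = cTgt q` (`runEnd_exitType_W3H`) — with `u := dist (E.δ q.1, E.δ a.1) < ρ/4`.
Then the exploration of `E` returns from the ball to its own exit corner `O₀ a N = q - w`
(`exists_returnJourney_W3H`), within `u + η` of the start vertex `z = E.δ a.1` (a collar point).

`ufrs_initialExitNear_twoScale`: at `z` the NAMED strands give, outside the escape regime and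
unless the NEAR branch of `ufrsCert` already holds (`u ≤ 256 η`), a TWO-SCALE JUNCTION
certificate: the marked edge `e_a` within `E.δ` of `z`, the marked edge `e_b + w` within
`u + E.δ`, two corner-disjoint strand-crossings `S₀`, `R₁` of `A(z; η, u)` and two corner-disjoint
strand-crossings `S₀`, `J = O₀ a [n+1, N]` of `A(z; u + η, ρ/4)`, with `256 η < u < ρ/4`.
`ufrs_initialExitNear_junction` packages this with a dyadic radius `R' ∈ (u/2, u]`
(`exists_dyadic_scale_W3H`): marked edge within `4η`, `R' = ρ/4/2^(k+1) ≥ 128 η`, two strands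
across `A(z; 4η, R')` and two across `A(z; 4R', ρ/4)` — the shape of a "junction" branch of the
certificate whose probability at the (four) marked edges is `≲ (η/R')^β (R'/ρ)^β = (η/ρ)^β` by the
junction two-strand decay. A THIRD strand-crossing of `A(z; 8η, R')`, which the MARKED branch of
`ufrsCert` asks for, is not among the named strands of the failure analysis (the return journey
`J` ends at distance `≈ u` from `z` and `R₁` has extent exactly `u`).

References: S. Smirnov, C. R. Acad. Sci. Paris 333 (2001), §2 (the exploration path runs from
`e_a` to `e_b`); P. Nolin, Electron. J. Probab. 13 (2008), §4 (arm events near boundary points).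
-/

namespace Summit.CriticalPhenomena.CardyFormulaZ2.Cruxes.EdgePrecompact.QkzStripBoundaryArm

open MeasureTheory Filter Set Metric
open scoped Topology BigOperators Pointwise
open Literature.Probability.LatticeModels Literature.Probability.Percolation
open Literature.Probability.RandomPlanarGeometry (DobrushinDomain)
open Summit.CriticalPhenomena.CardyFormulaZ2.Theses.CardyComplexCone

noncomputable section

/-- **INITIAL case with a nearby exit: the two-scale junction strands at the start vertex.**
DATA: the hypotheses of the residual `ufrs_initialExitNearCase_cert` (INITIAL branch of
`ufrs_failureStructure` with corner-disjoint start strands, the run of the translate leaving its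
inner faces at `T + 1` with `O₁ a' T` within `ρ/4` of the start vertex). CONCLUSION: at the collar
point `z = E.δ a.1`, either `ω ∈ ufrsCert E w z (4η) (ρ/2)` (escape regime, or the NEAR branch from
`S₀` and the return journey when the exit is within `256 η`), or the explicit two-scale junction
data: `e_a` within `E.δ` of `z`, a radius `u ∈ (256 η, ρ/4)` (the distance from `z` to the exit
vertex of the translate) with a marked edge of the translate within `u + E.δ`, two strand-crossings
of `A(z; η, u)` (`S₀` and the run `R₁`) and two strand-crossings of `A(z; u + η, ρ/4)` (`S₀` and the
return journey `J = O₀ a [n+1, N]` to the exit corner `O₀ a N = O₁ a' T - w` of `E`). -/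
theorem ufrs_initialExitNear_twoScale : ∀ (D : DobrushinDomain) (η : ℝ), 0 < η → ∃ δ₀ > (0:ℝ), ∀ E : DiscreteDobrushin, E.Ω = D.carrier → E.IsZdAdmissible → E.δ < δ₀ → ∀ (v w : Site 2) (ρ : ℝ), 4 * η ≤ ρ → 2 * ρ ≤ infDist (meshPoint E.δ v) D.carrierᶜ → ‖meshPoint E.δ w‖ < η → ∀ (ω : BondConfig (Site 2)) (a a' : Site 2 × Fin 4) (n T : ℕ), E.IsStartCorner a → (shiftData E w).IsStartCorner a' → (∀ i < n, medialPoint E.δ (cTgt (cornerOrbit (E.bcBondConfig ω) a i)) ∉ ball (meshPoint E.δ v) ρ ∧ E.IsInnerFace (cFace (cornerOrbit (E.bcBondConfig ω) a (i + 1)))) → medialPoint E.δ (cTgt (cornerOrbit (E.bcBondConfig ω) a n)) ∈ ball (meshPoint E.δ v) ρ → (∀ m k : ℕ, m ≤ n → (∀ i < k, medialPoint E.δ (cTgt (cornerOrbit ((shiftData E w).bcBondConfig ω) a' i)) ∉ ball (meshPoint E.δ v) ρ ∧ (shiftData E w).IsInnerFace (cFace (cornerOrbit ((shiftData E w).bcBondConfig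 ω) a' (i + 1)))) → cornerOrbit ((shiftData E w).bcBondConfig ω) a' k = cornerOrbit (E.bcBondConfig ω) a m → ∑ i ∈ Finset.range k, turnOf ((shiftData E w).bcBondConfig ω) (cornerOrbit ((shiftData E w).bcBondConfig ω) a' i) ≠ ∑ i ∈ Finset.range m, turnOf (E.bcBondConfig ω) (cornerOrbit (E.bcBondConfig ω) a i)) → (∀ i < T, medialPoint E.δ (cTgt (cornerOrbit ((shiftData E w).bcBondConfig ω) a' i)) ∉ ball (meshPoint E.δ v) ρ ∧ (shiftData E w).IsInnerFace (cFace (cornerOrbit ((shiftData E w).bcBondConfig ω) a' (i + 1)))) → ¬ (shiftData E w).IsInnerFace (cFace (cornerOrbit ((shiftData E w).bcBondConfig ω) a' (T + 1))) → (∀ j ≤ T, ∀ i ≤ n, cornerOrbit ((shiftData E w).bcBondConfig ω) a' j ≠ cornerOrbit (E.bcBondConfig ω) a i) → dist (meshPoint E.δ (cornerOrbit ((shiftData E w).bcBondConfig ω) a' T).1) (meshPoint E.δ a.1) < ρ / 2 / 2 → ∃ z ∈ D.carrier, infDist z D.carrierᶜ < 3 * η ∧ (ω ∈ ufrsCert E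 w z (4 * η) (ρ / 2) ∨ (z ∈ ufrsMarkedNbhd E w E.δ ∧ ∃ u : ℝ, 64 * (4 * η) < u ∧ u < ρ / 2 / 2 ∧ (∃ e₁ ∈ (shiftData E w).zdABEdges, dist (medialPoint E.δ e₁) z ≤ u + E.δ) ∧ ω ∈ ufrsStrands E w z 2 η u ∧ ω ∈ ufrsStrands E w z 2 (u + η) (ρ / 2 / 2))) := by
  intro D η hη
  obtain ⟨δ₂, hδ₂, hcollar⟩ := collarAgreement D η hη
  refine ⟨min δ₂ η, lt_min hδ₂ hη, ?_⟩
  intro E hEΩ hE hEδ v w ρ hηρ hv hw ω a a' n T ha ha' hStr hball _ hrun hout hdisj hDF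
  have hδ : 0 < E.δ := hE.delta_pos
  have hδ₂' : E.δ < δ₂ := lt_of_lt_of_le hEδ (min_le_left _ _)
  have hδη : E.δ ≤ η := (lt_of_lt_of_le hEδ (min_le_right _ _)).le
  have hE₁ : (shiftData E w).IsZdAdmissible := isZdAdmissible_shiftData E w hE
  have ha'eq : a' = (a.1 + w, a.2) := eq_shift_of_isStartCorner hE ha ha'
  -- inner faces at deep vertices
  have hinner : ∀ x : Site 2, 3 * η ≤ infDist (meshPoint E.δ x) D.carrierᶜ → ∀ f : Site 2,
      IsCorner x f → E.IsInnerFace f ∧ (shiftData E w).IsInnerFace f := fun x hx =>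
    (hcollar E hEΩ hE hδ₂' w hw ω x hx x (by rw [dist_self]; positivity)).2
  -- the start vertex is a collar point of `D`
  have hcol : infDist (meshPoint E.δ a.1) D.carrierᶜ < 3 * η := by
    by_contra hdeep
    rw [not_lt] at hdeep
    exact ha.isOutEdge.2 (hinner a.1 hdeep _ (isCorner_faceAt _ _)).1
  have hzD : (meshPoint E.δ a.1) ∈ D.carrier := by
    rw [← hEΩ]
    exact (ufrs_discrepancyEdges E w ω).2.2 a ha.isOutEdge.1
  refine ⟨meshPoint E.δ a.1, hzD, hcol, ?_⟩
  -- escape regime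
  by_cases hesc : ρ / 2 < 256 * (4 * η)
  · exact Or.inl (mem_ufrsCert_of_lt_W3H hesc)
  rw [not_lt] at hesc
  -- the faces of the two start strands are inner
  have hface₀ : ∀ t ≤ n, E.IsInnerFace (cFace (cornerOrbit (E.bcBondConfig ω) a t)) := by
    intro t ht
    rcases Nat.eq_zero_or_pos t with rfl | hpos
    · exact ha.isOutEdge.1
    · obtain ⟨t', rfl⟩ : ∃ t', t = t' + 1 := ⟨t - 1, by omega⟩
      exact (hStr t' (by omega)).2
  have hface₁ : ∀ t ≤ T, (shiftData E w).IsInnerFace (cFace (cornerOrbit ((shiftData E w).bcBondConfig ω) a' t)) := by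
    intro t ht
    rcases Nat.eq_zero_or_pos t with rfl | hpos
    · exact ha'.isOutEdge.1
    · obtain ⟨t', rfl⟩ : ∃ t', t = t' + 1 := ⟨t - 1, by omega⟩
      exact (hrun t' (by omega)).2
  -- the run leaves the inner faces of the translate at its exit corner `q`
  set q := cornerOrbit ((shiftData E w).bcBondConfig ω) a' T with hq
  have ha'B : a'.1 ∉ (shiftData E w).zdArcB := Set.disjoint_left.1 hE₁.disjoint ha'.mem_zdArcA
  obtain ⟨-, hqA, hqB, hqIn, hqAB⟩ := runEnd_exitType_W3H hE ω w (hface₁ T le_rfl) hout (Or.inl ha'B)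
  -- the return journey of the exploration of `E` to its exit corner `q - w`
  have hdeepn : ∀ f, IsCorner (cornerOrbit (E.bcBondConfig ω) a n).1 f → E.IsInnerFace f := fun f hf =>
    (hinner _ (deep_of_cTgt_mem_ball_W3H hδ.le hδη hηρ hv hball) f hf).1
  obtain ⟨N, hnN, hfaceN, hsimpleN, hexit⟩ :=
    exists_returnJourney_W3H hE ω ha (fun t ht => (hStr t ht).2) hdeepn hqA hqB hqIn
  -- distances from the start vertex
  set u := dist (meshPoint E.δ q.1) (meshPoint E.δ a.1) with hu
  have hu0 : 0 ≤ u := dist_nonneg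
  have hfar₀ : ρ - 3 * η - 2 * E.δ - 0 < dist (meshPoint E.δ (cornerOrbit (E.bcBondConfig ω) a n).1) (meshPoint E.δ a.1) :=
    far_of_near_cTgt_mem_ball_W3H hδ.le hv hcol (by rw [dist_self]) hball (by rw [dist_self]; exact hδ.le)
  have hfar₁ : ρ - 3 * η - 2 * E.δ - 0 < dist (meshPoint E.δ (cornerOrbit (E.bcBondConfig ω) a (n + 1)).1) (meshPoint E.δ a.1) :=
    far_of_near_cTgt_mem_ball_W3H hδ.le hv hcol (by rw [dist_self]) hball
      ((dist_meshPoint_cornerOrbit_succ_le _ _ _ _).trans (abs_of_pos hδ).le)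
  have hnear₁ : dist (meshPoint E.δ (cornerOrbit ((shiftData E w).bcBondConfig ω) a' 0).1) (meshPoint E.δ a.1) ≤ η := by
    have h1 : (cornerOrbit ((shiftData E w).bcBondConfig ω) a' 0).1 = a.1 + w := by
      show a'.1 = a.1 + w
      rw [ha'eq]
    rw [h1, meshPoint_add_shift, dist_eq_norm, add_sub_cancel_right]
    exact hw.le
  have hendN : dist (meshPoint E.δ (cornerOrbit (E.bcBondConfig ω) a N).1) (meshPoint E.δ a.1) ≤ u + η := by
    rw [hexit]
    have h1 := dist_meshPoint_sub_shift_W3H E.δ w q.1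
    have h2 := dist_triangle (meshPoint E.δ (q.1 - w)) (meshPoint E.δ q.1) (meshPoint E.δ a.1)
    show dist (meshPoint E.δ (q.1 - w)) (meshPoint E.δ a.1) ≤ u + η
    linarith [hw.le]
  have hmark₁ : dist (medialPoint E.δ (cTgt q)) (meshPoint E.δ a.1) ≤ u + E.δ := by
    have h1 := dist_medialPoint_cTgt_le' hδ.le q
    have h2 := dist_triangle (medialPoint E.δ (cTgt q)) (meshPoint E.δ q.1) (meshPoint E.δ a.1)
    linarith
  -- the three named strands in the format of `ufrsStrands`
  have hσ₀ : ∀ r R' : ℝ, 0 ≤ r → R' ≤ ρ - 3 * η - 2 * E.δ →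
      0 ≤ n ∧ ((dist (meshPoint E.δ (cornerOrbit (E.bcBondConfig ω) a 0).1) (meshPoint E.δ a.1) ≤ r ∧ R' ≤ dist (meshPoint E.δ (cornerOrbit (E.bcBondConfig ω) a n).1) (meshPoint E.δ a.1)) ∨ (R' ≤ dist (meshPoint E.δ (cornerOrbit (E.bcBondConfig ω) a 0).1) (meshPoint E.δ a.1) ∧ dist (meshPoint E.δ (cornerOrbit (E.bcBondConfig ω) a n).1) (meshPoint E.δ a.1) ≤ r)) ∧ (∀ t, 0 ≤ t → t ≤ n → E.IsInnerFace (cFace (cornerOrbit (E.bcBondConfig ω) a t))) ∧ (∀ s t, 0 ≤ s → s < t → t ≤ n → cornerOrbit (E.bcBondConfig ω) a s ≠ cornerOrbit (E.bcBondConfig ω) a t) := by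
    intro r R' hr hR'
    refine ⟨Nat.zero_le _, Or.inl ⟨?_, by linarith⟩, fun t _ ht => hface₀ t ht, fun s t _ hst htn => hsimpleN s t hst (by omega)⟩
    show dist (meshPoint E.δ a.1) (meshPoint E.δ a.1) ≤ r
    rw [dist_self]
    exact hr
  have hσ₁ : ∀ r R' : ℝ, η ≤ r → R' ≤ u →
      0 ≤ T ∧ ((dist (meshPoint E.δ (cornerOrbit ((shiftData E w).bcBondConfig ω) a' 0).1) (meshPoint E.δ a.1) ≤ r ∧ R' ≤ dist (meshPoint E.δ (cornerOrbit ((shiftData E w).bcBondConfig ω) a' T).1) (meshPoint E.δ a.1)) ∨ (R' ≤ dist (meshPoint E.δ (cornerOrbit ((shiftData E w).bcBondConfig ω) a' 0).1) (meshPoint E.δ a.1) ∧ dist (meshPoint E.δ (cornerOrbit ((shiftData E w).bcBondConfig ω) a' T).1) (meshPoint E.δ a.1) ≤ r)) ∧ (∀ t, 0 ≤ t → t ≤ T → (shiftData E w).IsInnerFace (cFace (cornerOrbit ((shiftData E w).bcBondConfig ω) a' t))) ∧ (∀ s t, 0 ≤ s → s < t → t ≤ T → cornerOrbit ((shiftData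 E w).bcBondConfig ω) a' s ≠ cornerOrbit ((shiftData E w).bcBondConfig ω) a' t) := by
    intro r R' hr hR'
    refine ⟨Nat.zero_le _, Or.inl ⟨hnear₁.trans hr, ?_⟩, fun t _ ht => hface₁ t ht,
      fun s t _ hst htT => cornerOrbit_ne hE₁ ha' hst (fun k hk => hface₁ k (by omega))⟩
    show R' ≤ dist (meshPoint E.δ q.1) (meshPoint E.δ a.1)
    exact hR'
  have hσJ : ∀ r R' : ℝ, u + η ≤ r → R' ≤ ρ - 3 * η - 2 * E.δ →
      n + 1 ≤ N ∧ ((dist (meshPoint E.δ (cornerOrbit (E.bcBondConfig ω) a (n + 1)).1) (meshPoint E.δ a.1) ≤ r ∧ R' ≤ dist (meshPoint E.δ (cornerOrbit (E.bcBondConfig ω) a N).1) (meshPoint E.δ a.1)) ∨ (R' ≤ dist (meshPoint E.δ (cornerOrbit (E.bcBondConfig ω) a (n + 1)).1) (meshPoint E.δ a.1) ∧ dist (meshPoint E.δ (cornerOrbit (E.bcBondConfig ω) a N).1) (meshPoint E.δ a.1) ≤ r)) ∧ (∀ t, n + 1 ≤ t → t ≤ N → E.IsInnerFace (cFace (cornerOrbit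 (E.bcBondConfig ω) a t))) ∧ (∀ s t, n + 1 ≤ s → s < t → t ≤ N → cornerOrbit (E.bcBondConfig ω) a s ≠ cornerOrbit (E.bcBondConfig ω) a t) := by
    intro r R' hr hR'
    exact ⟨by omega, Or.inr ⟨by linarith, hendN.trans hr⟩, fun t _ ht => hfaceN t ht, fun s t _ hst htN => hsimpleN s t hst htN⟩
  have hd₀₁ : ∀ s t, 0 ≤ s → s ≤ n → 0 ≤ t → t ≤ T → cornerOrbit (E.bcBondConfig ω) a s ≠ cornerOrbit ((shiftData E w).bcBondConfig ω) a' t :=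
    fun s t _ hs _ ht h => hdisj t ht s hs h.symm
  have hd₀J : ∀ s t, 0 ≤ s → s ≤ n → n + 1 ≤ t → t ≤ N → cornerOrbit (E.bcBondConfig ω) a s ≠ cornerOrbit (E.bcBondConfig ω) a t :=
    fun s t _ hs ht htN => hsimpleN s t (by omega) htN
  have hmark₀ : ∀ ρ' : ℝ, E.δ ≤ ρ' → meshPoint E.δ a.1 ∈ ufrsMarkedNbhd E w ρ' := by
    intro ρ' hρ'
    rw [mem_ufrsMarkedNbhd_iff]
    refine ⟨cSrc a, Or.inl (DiscreteDobrushin.cSrc_mem_zdABEdges ha.mem_zdArcA ha.mem_zdArcB (Or.inl ha.isOutEdge)), ?_⟩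
    exact (dist_medialPoint_cSrc_le' hδ.le a).trans hρ'
  have huρ : u < ρ / 2 / 2 := hDF
  -- NEAR, or the two-scale junction data
  by_cases hun : u ≤ 64 * (4 * η)
  · left
    apply mem_ufrsCert_of_near_W3H
    apply mem_ufrsCertNear_of_strands_W3H (hmark₀ _ (by linarith))
    exact mem_ufrsStrands_two_W3H true true a a 0 n (n + 1) N (hσ₀ _ _ (by positivity) (by linarith))
      (hσJ _ _ (by linarith) (by linarith)) hd₀J
  · right
    rw [not_le] at hun
    refine ⟨hmark₀ _ le_rfl, u, hun, huρ, ⟨cTgt q, hqAB, hmark₁⟩, ?_, ?_⟩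
    · exact mem_ufrsStrands_two_W3H true false a a' 0 n 0 T (hσ₀ _ _ hη.le (by linarith))
        (hσ₁ _ _ le_rfl le_rfl) hd₀₁
    · exact mem_ufrsStrands_two_W3H true true a a 0 n (n + 1) N (hσ₀ _ _ (by positivity) (by linarith))
        (hσJ _ _ le_rfl (by linarith)) hd₀J

/-- **INITIAL case with a nearby exit, junction form.** Same data as
`ufrs_initialExitNear_twoScale`; CONCLUSION: at a collar point `z`, `ω ∈ ufrsCert E w z (4η) (ρ/2)`
or the JUNCTION data in the format of the branches of `ufrsCert` (`r = 4η`, `R = ρ/2`): a marked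
edge within `r` of `z`, a dyadic radius `R' = R/2/2^(k+1)` with `32 r ≤ R'`, two strand-crossings
of `A(z; r, R')` and two strand-crossings of `A(z; 4R', R/2)`. Proof: the dyadic radius in
`(u/2, u]` (`exists_dyadic_scale_W3H`; `R' < R/2` forces the exponent `k + 1`) and monotonicity
of `ufrsStrands` in the radii. This is the residual `ufrs_initialExitNearCase_cert` up to the
extra "junction" alternative, which is not a branch of `ufrsCert`. -/
theorem ufrs_initialExitNear_junction : ∀ (D : DobrushinDomain) (η : ℝ), 0 < η → ∃ δ₀ > (0:ℝ), ∀ E : DiscreteDobrushin, E.Ω = D.carrier → E.IsZdAdmissible → E.δ < δ₀ → ∀ (v w : Site 2) (ρ : ℝ), 4 * η ≤ ρ → 2 * ρ ≤ infDist (meshPoint E.δ v) D.carrierᶜ → ‖meshPoint E.δ w‖ < η → ∀ (ω : BondConfig (Site 2)) (a a' : Site 2 × Fin 4) (n T : ℕ), E.IsStartCorner a → (shiftData E w).IsStartCorner a' → (∀ i < n, medialPoint E.δ (cTgt (cornerOrbit (E.bcBondConfig ω) a i)) ∉ ball (meshPoint E.δ v) ρ ∧ E.IsInnerFace (cFace (cornerOrbit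 (E.bcBondConfig ω) a (i + 1)))) → medialPoint E.δ (cTgt (cornerOrbit (E.bcBondConfig ω) a n)) ∈ ball (meshPoint E.δ v) ρ → (∀ m k : ℕ, m ≤ n → (∀ i < k, medialPoint E.δ (cTgt (cornerOrbit ((shiftData E w).bcBondConfig ω) a' i)) ∉ ball (meshPoint E.δ v) ρ ∧ (shiftData E w).IsInnerFace (cFace (cornerOrbit ((shiftData E w).bcBondConfig ω) a' (i + 1)))) → cornerOrbit ((shiftData E w).bcBondConfig ω) a' k = cornerOrbit (E.bcBondConfig ω) a m → ∑ i ∈ Finset.range k, turnOf ((shiftData E w).bcBondConfig ω) (cornerOrbit ((shiftData E w).bcBondConfig ω) a' i) ≠ ∑ i ∈ Finset.range m, turnOf (E.bcBondConfig ω) (cornerOrbit (E.bcBondConfig ω) a i)) → (∀ i < T, medialPoint E.δ (cTgt (cornerOrbit ((shiftData E w).bcBondConfig ω) a' i)) ∉ ball (meshPoint E.δ v) ρ ∧ (shiftData E w).IsInnerFace (cFace (cornerOrbit ((shiftData E w).bcBondConfig ω) a' (i + 1)))) → ¬ (shiftData E w).IsInnerFace (cFace (cornerOrbit ((shiftData E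 w).bcBondConfig ω) a' (T + 1))) → (∀ j ≤ T, ∀ i ≤ n, cornerOrbit ((shiftData E w).bcBondConfig ω) a' j ≠ cornerOrbit (E.bcBondConfig ω) a i) → dist (meshPoint E.δ (cornerOrbit ((shiftData E w).bcBondConfig ω) a' T).1) (meshPoint E.δ a.1) < ρ / 2 / 2 → ∃ z ∈ D.carrier, infDist z D.carrierᶜ < 3 * η ∧ (ω ∈ ufrsCert E w z (4 * η) (ρ / 2) ∨ (z ∈ ufrsMarkedNbhd E w (4 * η) ∧ ∃ R' : ℝ, (∃ k : ℕ, R' = ρ / 2 / 2 / 2 ^ (k + 1)) ∧ 32 * (4 * η) ≤ R' ∧ ω ∈ ufrsStrands E w z 2 (4 * η) R' ∧ ω ∈ ufrsStrands E w z 2 (4 * R') (ρ / 2 / 2))) := by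
  intro D η hη
  obtain ⟨δ₀, hδ₀, h⟩ := ufrs_initialExitNear_twoScale D η hη
  refine ⟨min δ₀ η, lt_min hδ₀ hη, ?_⟩
  intro E hEΩ hE hEδ v w ρ hηρ hv hw ω a a' n T ha ha' hStr hball hinit hrun hout hdisj hDF
  have hδ₀' : E.δ < δ₀ := lt_of_lt_of_le hEδ (min_le_left _ _)
  have hδη : E.δ ≤ η := (lt_of_lt_of_le hEδ (min_le_right _ _)).le
  obtain ⟨z, hzD, hzc, hcert | ⟨hmk, u, hu₁, hu₂, -, h₁, h₂⟩⟩ :=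
    h E hEΩ hE hδ₀' v w ρ hηρ hv hw ω a a' n T ha ha' hStr hball hinit hrun hout hdisj hDF
  · exact ⟨z, hzD, hzc, Or.inl hcert⟩
  refine ⟨z, hzD, hzc, Or.inr ⟨?_, ?_⟩⟩
  · rw [mem_ufrsMarkedNbhd_iff] at hmk ⊢
    obtain ⟨e₀, he₀, hd⟩ := hmk
    exact ⟨e₀, he₀, by linarith⟩
  · have hu0 : 0 < u := by linarith
    obtain ⟨k, hk₁, hk₂⟩ := exists_dyadic_scale_W3H (R := ρ / 2) (x := u) hu0 hu₂.le
    -- `R' < ρ/4` forces `k ≥ 1`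
    have hkpos : k ≠ 0 := by
      rintro rfl
      rw [pow_zero, div_one] at hk₂
      linarith
    obtain ⟨k', rfl⟩ : ∃ k', k = k' + 1 := ⟨k - 1, by omega⟩
    refine ⟨ρ / 2 / 2 / 2 ^ (k' + 1), ⟨k', rfl⟩, by linarith, ?_, ?_⟩
    · exact ufrsStrands_mono_W3H (by linarith) hk₂ h₁
    · exact ufrsStrands_mono_W3H (by linarith) le_rfl h₂

end

end Summit.CriticalPhenomena.CardyFormulaZ2.Cruxes.EdgePrecompact.QkzStripBoundaryArm
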